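import Summits.FinalStateConjecture.FinalStateConjecture.Theorems.EIHFluxBalanceInertialRecessionStubQuasiStationarityBound

/-!
# Route EIHFluxBalance — `InertialRecession`, line `sublinear-is-free-clean-window-charges`,
# stub `stub_quasiStationarity`: the weighted rate and the per-hole eventual estimate

Helper file (part 6 of the kinematic reduction of the stub `stub_quasiStationarity` of the crux
`stmt-FinalStateConjecture-10166`). The weight of the stub is `1 + d^{7/4}` with
`d^{7/4} = √(√(d⁷))`; against the kernels `M/d` (rate channel) and `M/d²` (drift channel) of
`norm_fderiv_summand_basisVector_zero_le` it leaves `d^{3/4} ≤ (2t)^{3/4}` on the cone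
`|x̲| ≤ κt` and `d^{-1/4} ≤ ρ(t)^{-1/4}` beyond the exclusion radius `ρ(t)`. Hence
(`eventually_weighted_fderiv_summand_le`): if the WEIGHTED RATES
`t^{3/4}(‖(Λe₀)˙‖ + [a ≠ 0]‖(Λe₃)˙‖) → 0` and the drift `ξ̇` is eventually bounded, then for every
`δ > 0`, eventually in `t`, `(1 + √(√(dᵢ⁷))) ‖D Sᵢ(x)[e₀]‖ ≤ δ` uniformly for `x` on the slab inside
the cone at distance `dᵢ ≥ ρ(t)` from the centre. Arithmetic is done in the fourth root
`s = √(√d)` (`fourthRoot_props`, `weight_arith`).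
-/

noncomputable section

namespace Summit.FinalStateConjecture.FinalStateConjecture.Theorems.SublinearIsFree.QuasiStationarity

open scoped BigOperators Topology ContDiff
open Filter Set Function Literature.Geometry.Lorentzian
open Summit.FinalStateConjecture.FinalStateConjecture.Theorems
open Summit.FinalStateConjecture.FinalStateConjecture.Theorems.InertialRecession.Negative

/-! ### Fourth-root arithmetic of the weight `1 + d^{7/4}` -/

/-- For `d ≥ 0`, the fourth root `s = √(√d)` satisfies `s ≥ 0`, `s⁴ = d` and
`√(√(d⁷)) = s⁷` (so the stub's weight is `1 + s⁷`). [folklore] -/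
theorem fourthRoot_props {d : ℝ} (hd : 0 ≤ d) :
    0 ≤ √(√d) ∧ √(√d) ^ 4 = d ∧ √(√(d ^ 7)) = √(√d) ^ 7 := by
  set s := √(√d) with hs
  have hs0 : 0 ≤ s := Real.sqrt_nonneg _
  have hs2 : s ^ 2 = √d := Real.sq_sqrt (Real.sqrt_nonneg d)
  have hs4 : s ^ 4 = d := by
    rw [show s ^ 4 = (s ^ 2) ^ 2 by ring, hs2, Real.sq_sqrt hd]
  refine ⟨hs0, hs4, ?_⟩
  rw [← hs4, show (s ^ 4) ^ 7 = (s ^ 14) ^ 2 by ring, Real.sqrt_sq (by positivity),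
    show s ^ 14 = (s ^ 7) ^ 2 by ring, Real.sqrt_sq (by positivity)]

/-- `t^{3/4} = (√(√t))³` for `t ≥ 0` (the weighted rate in fourth-root form). [folklore] -/
theorem rpow_three_quarters_eq {t : ℝ} (ht : 0 ≤ t) : t ^ (3 / 4 : ℝ) = √(√t) ^ 3 := by
  have h1 : √(√t) = t ^ (1 / 4 : ℝ) := by
    rw [Real.sqrt_eq_rpow, Real.sqrt_eq_rpow, ← Real.rpow_mul ht]
    norm_num
  rw [h1, ← Real.rpow_natCast, ← Real.rpow_mul ht]
  norm_num

/-- **The weight against the two kernels.** For `s ≥ 1` (`d = s⁴ ≥ 1`), `s ≤ 2τ` (cone),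
`η⁻¹ ≤ s` (exclusion radius) and `τ³ r ≤ η` (weighted rate):
`(1 + s⁷)(C₁ r / s⁴ + C₂ V / s⁸) ≤ (16 C₁ + 2 C₂ V) η`. [folklore] -/
theorem weight_arith {s τ η r V C₁ C₂ : ℝ} (hs1 : 1 ≤ s) (hsτ : s ≤ 2 * τ) (hη : 0 < η)
    (hsη : η⁻¹ ≤ s) (hr : 0 ≤ r) (hrτ : τ ^ 3 * r ≤ η) (hV : 0 ≤ V) (hC₁ : 0 ≤ C₁)
    (hC₂ : 0 ≤ C₂) :
    (1 + s ^ 7) * (C₁ * r / s ^ 4 + C₂ * V / (s ^ 4) ^ 2) ≤ (16 * C₁ + 2 * C₂ * V) * η := by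
  have hs0 : 0 < s := one_pos.trans_le hs1
  have hτ0 : 0 ≤ τ := by linarith
  have h7 : 1 ≤ s ^ 7 := one_le_pow₀ hs1
  -- the rate channel: `(1 + s⁷)/s⁴ ≤ 2 s³ ≤ 16 τ³`
  have hA : (1 + s ^ 7) * (C₁ * r / s ^ 4) ≤ 16 * C₁ * η := by
    have h1 : (1 + s ^ 7) * (C₁ * r / s ^ 4) ≤ 2 * s ^ 3 * (C₁ * r) := by
      rw [mul_div_assoc', div_le_iff₀ (by positivity)]
      have : 2 * s ^ 3 * (C₁ * r) * s ^ 4 = 2 * s ^ 7 * (C₁ * r) := by ring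
      rw [this]
      nlinarith [mul_nonneg hC₁ hr]
    have h2 : s ^ 3 ≤ 8 * τ ^ 3 := by
      have := pow_le_pow_left₀ hs0.le hsτ 3
      nlinarith [this]
    have h3 : 2 * s ^ 3 * (C₁ * r) ≤ 16 * C₁ * (τ ^ 3 * r) := by nlinarith [mul_nonneg hC₁ hr]
    have h4 : 16 * C₁ * (τ ^ 3 * r) ≤ 16 * C₁ * η := by nlinarith
    linarith
  -- the drift channel: `(1 + s⁷)/s⁸ ≤ 2/s ≤ 2η`
  have hB : (1 + s ^ 7) * (C₂ * V / (s ^ 4) ^ 2) ≤ 2 * C₂ * V * η := by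
    have hinv : s⁻¹ ≤ η := inv_le_of_inv_le₀ hη hsη
    have h1 : (1 + s ^ 7) * (C₂ * V / (s ^ 4) ^ 2) ≤ 2 * s⁻¹ * (C₂ * V) := by
      rw [mul_div_assoc', div_le_iff₀ (by positivity)]
      have : 2 * s⁻¹ * (C₂ * V) * (s ^ 4) ^ 2 = 2 * s ^ 7 * (C₂ * V) := by
        field_simp
      rw [this]
      nlinarith [mul_nonneg hC₂ hV]
    have h2 : 2 * s⁻¹ * (C₂ * V) ≤ 2 * η * (C₂ * V) := by
      have := mul_nonneg hC₂ hV
      nlinarith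
    linarith
  calc (1 + s ^ 7) * (C₁ * r / s ^ 4 + C₂ * V / (s ^ 4) ^ 2)
      = (1 + s ^ 7) * (C₁ * r / s ^ 4) + (1 + s ^ 7) * (C₂ * V / (s ^ 4) ^ 2) := by ring
    _ ≤ 16 * C₁ * η + 2 * C₂ * V * η := add_le_add hA hB
    _ = (16 * C₁ + 2 * C₂ * V) * η := by ring

/-! ### The per-hole eventual estimate -/

/-- The derivative of `s ↦ Λ(s)e_μ` is `Λ̇ e_μ` (bookkeeping between the rates of the stub, stated on
the columns `Λ e₀`, `Λ e₃`, and the operator derivative `Λ̇`). [folklore] -/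
theorem deriv_lorentz_apply_basisVector {Λ : ℝ → lorentzGroup} {t : ℝ} {L' : E4 →L[ℝ] E4}
    (hΛ' : HasDerivAt (fun s ↦ ((Λ s : E4 ≃L[ℝ] E4) : E4 →L[ℝ] E4)) L' t) (μ : Fin 4) :
    deriv (fun s ↦ (Λ s : E4 ≃L[ℝ] E4) (E4.basisVector μ)) t = L' (E4.basisVector μ) := by
  have h := hΛ'.clm_apply (hasDerivAt_const t (E4.basisVector μ))
  simp only [map_zero, add_zero, ContinuousLinearEquiv.coe_coe] at h
  exact h.deriv

-- operator-norm instance paths on form-valued maps are slow to unify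
set_option synthInstance.maxHeartbeats 200000 in
/-- **Per-hole eventual weighted estimate.** For one summand `Sᵢ` of the background field with
`C¹` motion of Lorentz factor `≤ γ`, centre eventually inside `‖ξ(t)‖ ≤ κ²t` (`0 ≤ κ ≤ 1`) with
eventually bounded drift `‖ξ̇(t)‖ ≤ V`, and WEIGHTED RATES
`t^{3/4}(‖(Λe₀)˙(t)‖ + [a ≠ 0]‖(Λe₃)˙(t)‖) → 0`: for every exclusion radius `ρ(t) → ∞` and
every `δ > 0`, eventually in `t`, `(1 + √(√(dᵢ⁷))) ‖D Sᵢ(x)[e₀]‖ ≤ δ` for all slab points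
`x` (`x⁰ = t`) in the cone `|x̲| ≤ κt` with `dᵢ = ‖x̲ − ξ(t)‖ ≥ ρ(t)`. [folklore] -/
theorem eventually_weighted_fderiv_summand_le {M a γ κ V : ℝ} {Λ : ℝ → lorentzGroup} {ξ : ℝ → E3}
    (hΛ : ContDiff ℝ 1 (fun s ↦ ((Λ s : E4 ≃L[ℝ] E4) : E4 →L[ℝ] E4))) (hξ : ContDiff ℝ 1 ξ)
    (hγ : ∀ t, |((Λ t : E4 ≃L[ℝ] E4) (E4.basisVector 0)) 0| ≤ γ) (hκ0 : 0 ≤ κ) (hκ1 : κ ≤ 1)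
    (hξκ : ∀ᶠ t in atTop, ‖ξ t‖ ≤ κ ^ 2 * t) (hV : ∀ᶠ t in atTop, ‖deriv ξ t‖ ≤ V)
    (hrate : Tendsto (fun t ↦ t ^ (3 / 4 : ℝ) *
      (‖deriv (fun s ↦ (Λ s : E4 ≃L[ℝ] E4) (E4.basisVector 0)) t‖ +
        if a = 0 then 0 else ‖deriv (fun s ↦ (Λ s : E4 ≃L[ℝ] E4) (E4.basisVector 3)) t‖))
      atTop (𝓝 0))
    {ρ : ℝ → ℝ} (hρ : Tendsto ρ atTop atTop) {δ : ℝ} (hδ : 0 < δ) :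
    ∀ᶠ t in atTop, ∀ x : E4, x 0 = t → E4.spatialNorm x ≤ κ * t → ρ t ≤ ‖E4.spatial x - ξ t‖ →
      (1 + √(√(‖E4.spatial x - ξ t‖ ^ 7))) *
        ‖fderiv ℝ (fun y : E4 ↦ boostedKerrBilin (Λ (y 0)) (E4.ofTimeSpace (y 0) (ξ (y 0))) M a y -
          Minkowski.bilin) x (E4.basisVector 0)‖ ≤ δ := by
  obtain ⟨B₀, B₁, hB₀, hB₁, hmain⟩ := norm_fderiv_summand_basisVector_zero_le
  -- constants of the hole (no `set`: the context will be large)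
  have hγ1 : 1 ≤ γ := (one_le_abs_lorentz_apply_zero (Λ 0)).trans (hγ 0)
  have hG0 : 0 ≤ 1 + 3 * γ := by linarith
  obtain ⟨C₁, hC₁⟩ : ∃ C₁ : ℝ,
      C₁ = |M| * (1 + 3 * γ) ^ 2 * (B₁ * (1 + 3 * γ) + 2 * B₀) * (4 * (1 + 3 * γ)) := ⟨_, rfl⟩
  obtain ⟨C₂, hC₂⟩ : ∃ C₂ : ℝ, C₂ = |M| * (1 + 3 * γ) ^ 2 * (B₁ * (1 + 3 * γ)) := ⟨_, rfl⟩
  have hC₁0 : 0 ≤ C₁ := by rw [hC₁]; positivity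
  have hC₂0 : 0 ≤ C₂ := by rw [hC₂]; positivity
  have hVp0 : 0 ≤ max V 0 := le_max_right _ _
  obtain ⟨η, hη⟩ : ∃ η : ℝ, η = δ / (16 * C₁ + 2 * C₂ * max V 0 + 1) := ⟨_, rfl⟩
  have hden : 0 < 16 * C₁ + 2 * C₂ * max V 0 + 1 := by positivity
  have hη0 : 0 < η := by rw [hη]; exact div_pos hδ hden
  have hηδ : (16 * C₁ + 2 * C₂ * max V 0) * η ≤ δ := by
    rw [hη, mul_div_assoc', div_le_iff₀ hden]
    nlinarith
  -- eventual conditions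
  have h4 : ∀ᶠ t in atTop, t ^ (3 / 4 : ℝ) *
      (‖deriv (fun s ↦ (Λ s : E4 ≃L[ℝ] E4) (E4.basisVector 0)) t‖ +
        if a = 0 then 0 else ‖deriv (fun s ↦ (Λ s : E4 ≃L[ℝ] E4) (E4.basisVector 3)) t‖) < η :=
    hrate.eventually (gt_mem_nhds hη0)
  filter_upwards [eventually_ge_atTop (1 : ℝ), hξκ, hV, h4,
    hρ.eventually_ge_atTop (max 1 (2 * |a|)), hρ.eventually_ge_atTop (η⁻¹ ^ 4)]
    with t ht1 ht2 ht3 ht4 ht5 ht6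
  intro x hx hcone hρx
  have hd : max 1 (2 * |a|) ≤ ‖E4.spatial x - ξ t‖ := ht5.trans hρx
  have hd1 : 1 ≤ ‖E4.spatial x - ξ t‖ := (le_max_left _ _).trans hd
  have ht0 : 0 ≤ t := zero_le_one.trans ht1
  -- the motion at time `t` and the stabiliser correction
  have hΛ' : HasDerivAt (fun s ↦ ((Λ s : E4 ≃L[ℝ] E4) : E4 →L[ℝ] E4))
      (deriv (fun s ↦ ((Λ s : E4 ≃L[ℝ] E4) : E4 →L[ℝ] E4)) t) t :=
    (hΛ.differentiable one_ne_zero t).hasDerivAt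
  have hp : DifferentiableAt ℝ (fun y ↦ Kerr.bilin M a y - Minkowski.bilin)
      ((((Λ t : E4 ≃L[ℝ] E4).symm : E4 →L[ℝ] E4)) (E4.spaceEmbed (E4.spatial x - ξ t))) :=
    differentiableAt_ksPert_of_le (hd.trans (le_spatialNorm_restPosition (Λ t) _))
  obtain ⟨SK, hstab, hν⟩ := exists_stabiliser_correction M a γ Λ t hΛ' (hγ t) hp
  obtain ⟨r, hr⟩ : ∃ r : ℝ, r = ‖deriv (fun s ↦ ((Λ s : E4 ≃L[ℝ] E4) : E4 →L[ℝ] E4)) t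
      (E4.basisVector 0)‖ + if a = 0 then 0 else
        ‖deriv (fun s ↦ ((Λ s : E4 ≃L[ℝ] E4) : E4 →L[ℝ] E4)) t (E4.basisVector 3)‖ := ⟨_, rfl⟩
  have hr0 : 0 ≤ r := by
    rw [hr]; split_ifs <;> positivity
  have hν0 : 0 ≤ 4 * (1 + 3 * γ) * r := by positivity
  have hν' : ∀ u, ‖((((Λ t : E4 ≃L[ℝ] E4).symm : E4 →L[ℝ] E4)).comp
      (deriv (fun s ↦ ((Λ s : E4 ≃L[ℝ] E4) : E4 →L[ℝ] E4)) t) - SK) u‖ ≤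
        4 * (1 + 3 * γ) * r * ‖u‖ := fun u ↦ by
    rw [hr]
    exact hν u
  have hbound := hmain M a γ Λ ξ t x SK (4 * (1 + 3 * γ) * r) hΛ hξ (hγ t) hx hd hν0 hstab hν'
  clear hmain hstab hν hν' hp
  have hrate_t : t ^ (3 / 4 : ℝ) * r ≤ η := by
    rw [deriv_lorentz_apply_basisVector hΛ' 0, deriv_lorentz_apply_basisVector hΛ' 3] at ht4
    rw [hr]
    exact ht4.le
  -- fourth roots
  obtain ⟨hs0, hs4, hs7⟩ := fourthRoot_props (zero_le_one.trans hd1)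
  obtain ⟨hτ0, hτ4, -⟩ := fourthRoot_props ht0
  obtain ⟨s, hs⟩ : ∃ s : ℝ, s = √(√‖E4.spatial x - ξ t‖) := ⟨_, rfl⟩
  obtain ⟨τ, hτ⟩ : ∃ τ : ℝ, τ = √(√t) := ⟨_, rfl⟩
  rw [← hs] at hs0 hs4 hs7
  rw [← hτ] at hτ0 hτ4
  have hs1 : 1 ≤ s := by
    by_contra h
    have h' : s < 1 := lt_of_not_ge h
    have : s ^ 4 < 1 := pow_lt_one₀ hs0 h' (by norm_num)
    linarith
  have hd2t : ‖E4.spatial x - ξ t‖ ≤ 2 * t := by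
    have h1 : ‖E4.spatial x - ξ t‖ ≤ ‖E4.spatial x‖ + ‖ξ t‖ := norm_sub_le _ _
    have h2 : ‖E4.spatial x‖ ≤ κ * t := hcone
    have h3 : κ * t ≤ 1 * t := mul_le_mul_of_nonneg_right hκ1 ht0
    have hκ2 : κ ^ 2 ≤ 1 := pow_le_one₀ hκ0 hκ1
    have h4 : κ ^ 2 * t ≤ 1 * t := mul_le_mul_of_nonneg_right hκ2 ht0
    linarith
  have hsτ : s ≤ 2 * τ := by
    have h : s ^ 4 ≤ (2 * τ) ^ 4 := by
      rw [hs4, mul_pow, hτ4]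
      linarith
    exact (pow_le_pow_iff_left₀ hs0 (by positivity) (by norm_num)).mp h
  have hsη : η⁻¹ ≤ s := by
    have h : (η⁻¹) ^ 4 ≤ s ^ 4 := by rw [hs4]; exact ht6.trans hρx
    exact (pow_le_pow_iff_left₀ (by positivity) hs0 (by norm_num)).mp h
  have hrτ : τ ^ 3 * r ≤ η := by rwa [rpow_three_quarters_eq ht0, ← hτ] at hrate_t
  have hVt : ‖deriv ξ t‖ ≤ max V 0 := ht3.trans (le_max_left _ _)
  -- assemble
  have hstep : |M| * (1 + 3 * γ) ^ 2 * ((B₁ * (1 + 3 * γ) + 2 * B₀) * (4 * (1 + 3 * γ) * r) /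
      ‖E4.spatial x - ξ t‖ + B₁ * (1 + 3 * γ) * ‖deriv ξ t‖ / ‖E4.spatial x - ξ t‖ ^ 2) ≤
      C₁ * r / s ^ 4 + C₂ * max V 0 / (s ^ 4) ^ 2 := by
    rw [hs4]
    have h1 : |M| * (1 + 3 * γ) ^ 2 * ((B₁ * (1 + 3 * γ) + 2 * B₀) * (4 * (1 + 3 * γ) * r) /
        ‖E4.spatial x - ξ t‖ + B₁ * (1 + 3 * γ) * ‖deriv ξ t‖ / ‖E4.spatial x - ξ t‖ ^ 2) =
        C₁ * r / ‖E4.spatial x - ξ t‖ + C₂ * ‖deriv ξ t‖ / ‖E4.spatial x - ξ t‖ ^ 2 := by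
      rw [hC₁, hC₂]; ring
    rw [h1]
    have h2 : C₂ * ‖deriv ξ t‖ / ‖E4.spatial x - ξ t‖ ^ 2 ≤
        C₂ * max V 0 / ‖E4.spatial x - ξ t‖ ^ 2 := by
      gcongr
    linarith
  have hw := weight_arith hs1 hsτ hη0 hsη hr0 hrτ hVp0 hC₁0 hC₂0
  rw [hs7]
  calc (1 + s ^ 7) * ‖fderiv ℝ (fun y : E4 ↦ boostedKerrBilin (Λ (y 0))
        (E4.ofTimeSpace (y 0) (ξ (y 0))) M a y - Minkowski.bilin) x (E4.basisVector 0)‖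
      ≤ (1 + s ^ 7) * (C₁ * r / s ^ 4 + C₂ * max V 0 / (s ^ 4) ^ 2) :=
        mul_le_mul_of_nonneg_left (hbound.trans hstep) (by positivity)
    _ ≤ (16 * C₁ + 2 * C₂ * max V 0) * η := hw
    _ ≤ δ := hηδ

-- operator-norm instance paths on form-valued maps are slow to unify
set_option synthInstance.maxHeartbeats 200000 in
/-- Registered sub-goal form (stub `painted_summand_weighted_eventually` of the crux item) of
`eventually_weighted_fderiv_summand_le`: the per-hole eventual weighted estimate from weighted rates.
[folklore] -/
theorem painted_summand_weighted_eventually : open Literature.Geometry.Lorentzian Filter Topology in ∀ {M a γ κ V : ℝ} {Λ : ℝ → lorentzGroup} {ξ : ℝ → E3}, ContDiff ℝ 1 (fun s ↦ ((Λ s : E4 ≃L[ℝ] E4) : E4 →L[ℝ] E4)) → ContDiff ℝ 1 ξ → (∀ t, |((Λ t : E4 ≃L[ℝ] E4) (E4.basisVector 0)) 0| ≤ γ) → 0 ≤ κ → κ ≤ 1 → (∀ᶠ t in atTop, ‖ξ t‖ ≤ κ ^ 2 * t) → (∀ᶠ t in atTop, ‖deriv ξ t‖ ≤ V) → Tendsto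 (fun t ↦ t ^ (3 / 4 : ℝ) * (‖deriv (fun s ↦ (Λ s : E4 ≃L[ℝ] E4) (E4.basisVector 0)) t‖ + if a = 0 then 0 else ‖deriv (fun s ↦ (Λ s : E4 ≃L[ℝ] E4) (E4.basisVector 3)) t‖)) atTop (𝓝 0) → ∀ {ρ : ℝ → ℝ}, Tendsto ρ atTop atTop → ∀ {δ : ℝ}, 0 < δ → ∀ᶠ t in atTop, ∀ x : E4, x 0 = t → E4.spatialNorm x ≤ κ * t → ρ t ≤ ‖E4.spatial x - ξ t‖ → (1 + √(√(‖E4.spatial x - ξ t‖ ^ 7))) * ‖fderiv ℝ (fun y : E4 ↦ boostedKerrBilin (Λ (y 0)) (E4.ofTimeSpace (y 0) (ξ (y 0))) M a y - Minkowski.bilin) x (E4.basisVector 0)‖ ≤ δ :=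
  fun hΛ hξ hγ hκ0 hκ1 hξκ hV hrate _ hρ _ hδ ↦
    eventually_weighted_fderiv_summand_le hΛ hξ hγ hκ0 hκ1 hξκ hV hrate hρ hδ

end Summit.FinalStateConjecture.FinalStateConjecture.Theorems.SublinearIsFree.QuasiStationarity

end
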